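import Literature.AlgebraicGeometry.HodgeTheory.MotivatedClasses
import Literature.AlgebraicGeometry.HodgeTheory.MotivatedClassesTransport
import Literature.AlgebraicGeometry.HodgeTheory.GlobalInvariantCycles
import Literature.AlgebraicGeometry.Motives.ComplexPointsManifold
import Literature.AlgebraicGeometry.Motives.CompleteIntersectionLinesThroughPoints
import Literature.AlgebraicGeometry.Motives.CurveNet
import Literature.NumberTheory.Transcendental.AnalytificationConnectedProofs
import HarnessLib

/-!
# Towards André's deformation theorem (Théorème 0.5) on real carriers: proved steps

Companion (proof) file of `MotivatedClasses.lean` for its named fact `Andre1996_deformation` (the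
sibling `MotivatedClassesProofs.lean` serves the remark "`B` ⇒ `A_mot(X) = A(X)`" of §2.1, and
`MotivatedClassesAlgebraic.lean` the inclusion `A(X) ⊆ A_mot(X)`). The fact
(Y. André, *Pour une théorie inconditionnelle des motifs*, Publ. Math. IHÉS 83 (1996), Théorème de
déformation 0.5, p. 8, in global-class form: `A ∈ H²ᵖ(𝒳(ℂ); ℂ)` with `A|_{𝒳_{s₀}}` motivated has
`A|_{𝒳_s}` motivated for every `s`) is stated on the real carriers `complexBetti`,
`motivatedClasses`. The printed proof (§5.1, p. 25), verbatim in its steps: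

* (A0) "Soient […] `s`, `t` deux points de `S(ℂ)`. Il existe une variété affine lisse connexe `S'`
  (par exemple une courbe) et un morphisme `S' → S` tel que l'image de `S'(ℂ)` dans `S(ℂ)`
  contienne `s` et `t`. […] on peut remplacer `S` par `S'`";
* (A1) "dès lors, `X` est un schéma quasi projectif lisse, et il existe, d'après H. Hironaka, une
  compactification lisse `X̄` de `X`";
* (A2) "Nous nous appuierons sur le « théorème de la partie fixe » de Deligne [D71], 4.1.1, selon
  lequel l'application composée `u : H²ᵖ(X̄, ℚ) → H²ᵖ(X, ℚ) → H⁰(S, R²ᵖ f_* ℚ)` est surjective";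
* (A3) the motivic step: "Puisque la catégorie des motifs est abélienne (0.4)" and "la réalisation
  de Betti `H_B` est un foncteur exact", the kernel of `j_s^* : h(X̄)(p) → h(𝒳_s)(p)` is the same
  for `s` and `t`, the image motives are isomorphic to one quotient motive `N`, and "en fait, `ξ_s`
  provient d'un cycle motivé sur `X̄`" — on the carriers: a class of `X̄` whose restriction to
  `𝒳_s` is motivated has the same restriction as a MOTIVATED class of `X̄` (semisimplicity,
  Thm. 0.4);
* (A4) "`ξ_t = (H_B(j_t^* ∘ j_s^{*-1}))(ξ_s)`" — on global classes: a global class vanishing on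
  `𝒳_s` vanishes on `𝒳_t` (two global sections of the local system `R²ᵖ f_* ℚ` over the connected
  `S(ℂ)` agreeing at `s` agree at `t`);
* (A5) `j_t^*` of a motivated class of `X̄` is motivated (Prop. 2.1 (ii) with "le formalisme
  `f^*`, `f_*` (pour un morphisme `f`) en composant les correspondances motivées avec la classe du
  graphe de `f` ou sa transposée", p. 15: `A_mot` is stable under pull-backs).

None of (A0), (A1), (A3), (A4), (A5) is available on the real carriers (curve-connecting lemma and
invariance of `motivatedClasses` under isomorphisms of varieties; smooth compactifications; André's
Thm. 0.4, which rests on the Hodge index theorem for all smooth projective complex varieties;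
Ehresmann's theorem with homotopy invariance for `f(ℂ)`; Prop. 2.1 for the topological Gysin maps),
and (A2) is the tree's NAMED FACT `deligne_globalInvariantCycles` (`GlobalInvariantCycles.lean`,
Deligne, *Théorie de Hodge II*, Thm. 4.1.1, pointwise form over a smooth quasi-projective base).
This file records the steps that ARE provable now:

* `map_fiberι_mem_motivatedClasses_of_lt`: `Andre1996_deformation` in the degrees `p > n`,
  unconditionally and without hypothesis at `s₀` (`H²ᵖ(𝒳_s(ℂ); ℂ) = 0`, the fibre being a closed
  `2n`-manifold: the tree's `ComplexPoints.subsingleton_singularCohomology_of_lt`).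
* `globalSection_eq_globalSection_iff`: two global sections of the space of fibre classes agree at
  `s` iff the two restrictions to `𝒳_s` agree (bookkeeping of the dependent pair `FiberClass`).
* `exists_map_fiberι_comp_eq_of_deligne`: input (A2) in exactly the form the global-class
  statement consumes — over a smooth quasi-projective `S`, with `i : 𝒳 ⟶ X̄` an open immersion into
  a smooth projective `X̄`, every `A ∈ Hᵏ(𝒳(ℂ); ℂ)` has at each `s₀` the same restriction to
  `𝒳_{s₀}` as some class of `X̄` — from `deligne_globalInvariantCycles` applied to the continuous
  section `globalSection f k A` (only this "equality of images" half of the partie fixe, Voisin II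
  Prop. 4.23, enters the global-class form; Leray degeneration does not).
* `Andre1996_deformation_assembly`: (A2)–(A5) at `(s₀, s)` ⇒ the conclusion of
  `Andre1996_deformation` at `(s₀, s)`, the inputs being hypotheses in the form the carriers consume
  them (bookkeeping only: the closing lines of §5.1).
* `Andre1996_deformation_of_inputs`: the same over a smooth quasi-projective base and a smooth
  projective `X̄ ⊇ 𝒳`, with (A2) discharged by the named fact `deligne_globalInvariantCycles`.
* `Motives.AlgPoints.forall_of_irreducibleComponents`: on a connected scheme of finite type over an
  algebraically closed field, a property of rational points that propagates between points of a
  common irreducible component propagates between any two points (finitely many closed components,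
  closed points are rational points) — the step of (A0) André leaves implicit (a smooth connected
  `S'` has irreducible image in `S`, so a reducible connected `S` needs a chain of components).
* `Andre1996_deformation_of_irreducibleComponents`: hence `Andre1996_deformation` follows from its
  restriction to pairs `s, t ∈ S(ℂ)` on ONE irreducible component of `S` (connectedness of `S`
  dropped), which is what the curve `S' → S` of (A0) and (A1)–(A5) establish.

* `Motives.familyPullback f g` (with `.fst`, `.snd`, `isPullback`, `fiberOverFamilyPullbackIso`,
  `IsSmoothProjectiveFamily.familyPullback_snd`, `Motives.exists_isClosedImmersion_familyPullback`):
  base change `𝒳 ×_S S' ⟶ S'` of a family along `g : S' ⟶ S` ("la formation de `R²ᵖ f_* ℚ_X(p)`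
  commute à tout changement de base"): again a smooth projective family, projective in Hartshorne's
  sense, with fibres `(𝒳 ×_S S')_{s'} ≅ 𝒳_{g(s')}`.
* `map_fiberι_familyPullback_mem_motivatedClasses_iff`: being motivated is invariant under these
  isomorphisms of fibres (`map_mem_motivatedClasses_iff_of_iso`, file `MotivatedClassesTransport`).
* `Andre1996_deformation_of_curves`: **step (A0) assembled** — `Andre1996_deformation` follows from
  (i) the existence, for two points on one irreducible component of a `ℂ`-scheme of finite type, of a
  smooth irreducible quasi-projective `S' → S` through them (hypothesis `hcurve`: an irreducible
  curve through two points, normalised — NOT in the tree), and (ii) the statement for families over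
  smooth irreducible quasi-projective bases `S` with `S(ℂ)` connected (hypothesis `hmain`; the
  connectedness is supplied from SGA1 XII Prop. 2.4, the tree's PROVED
  `Motives.ComplexPoints.connectedSpace_iff_holds`).

* `Andre1996_deformation_of_classical_inputs`: the whole proof assembled — `Andre1996_deformation`
  from six hypotheses: the curve lemma (A0), smooth compactifications (A1), the named fact
  `deligne_globalInvariantCycles` (A2), the semisimple motivated lift of Thm. 0.4 (A3), flatness of
  fibre restrictions (A4) and Prop. 2.1 (ii) (A5), each as a clean statement on the real carriers.

What remains of `Andre1996_deformation` after this file is exactly these inputs: the curve lemma of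
(A0) (`hcurve`), and, over a smooth irreducible quasi-projective base with connected complex points,
(A1), (A3), (A4), (A5) and the named fact (A2).

## References

* [Andre1996Motifs] Y. André, Pour une théorie inconditionnelle des motifs, Publ. Math. IHÉS 83
  (1996) 5–49: Thm. 0.4 and Thm. 0.5 (p. 8), Prop. 2.1 (ii) (p. 14) and p. 15 (`f^*`, `f_*`),
  §5.1 (pp. 25–26).
* [DeligneHodgeII1971] P. Deligne, Théorie de Hodge II, Publ. Math. IHÉS 40 (1971), Thm. 4.1.1.
* [VoisinHodgeII2003] C. Voisin, Hodge Theory and Complex Algebraic Geometry II, §4.3, Prop. 4.23 and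
  Thm. 4.24.
* [HatcherAT2002] A. Hatcher, Algebraic Topology, §3.3 Thm. 3.26 (c).
-/

noncomputable section

open CategoryTheory CategoryTheory.Limits AlgebraicGeometry MonoidalCategory CartesianMonoidalCategory
open Literature.AlgebraicTopology.SingularHomology

namespace Literature.AlgebraicGeometry.HodgeTheory

/-! ### The degrees `p > n` -/

section Degrees

variable {n : ℕ} {𝒳 S : Motives.SchemeOver ℂ}

/-- **`Andre1996_deformation` in the degrees `p > n`, unconditionally.** For a smooth projective
family `f : 𝒳 ⟶ S` of relative dimension `n` and `p > n`, the restriction of ANY class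
`A ∈ H²ᵖ(𝒳(ℂ); ℂ)` to any fibre `𝒳_s` is motivated, because it is `0`: the fibre is a smooth
projective variety of dimension `n`, so `𝒳_s(ℂ)` is a closed `2n`-manifold and
`H²ᵖ(𝒳_s(ℂ); ℂ) = 0` for `2p > 2n` (Hatcher Thm. 3.26 (c) with universal coefficients; the tree's
`ComplexPoints.subsingleton_singularCohomology_of_lt`), while `0 ∈ A_motᵖ(𝒳_s)_ℂ` (a subspace; cf.
`motivatedClasses_eq_bot_of_lt`: there are no generators either). This is the part of Théorème 0.5
that needs no hypothesis at `s₀`. [cite: Andre1996Motifs, Thm. 0.5 (p. 8)]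
[cite: HatcherAT2002, §3.3 Thm. 3.26 (c)] -/
theorem map_fiberι_mem_motivatedClasses_of_lt (f : 𝒳 ⟶ S) (hf : Motives.IsSmoothProjectiveFamily f n)
    {p : ℕ} (hp : n < p) (A : complexBetti 𝒳 (2 * p)) (s : Motives.ComplexPoints S) :
    complexBetti.map (Motives.fiberι f s) (2 * p) A ∈ motivatedClasses n (Motives.fiberOver f s) p := by
  haveI := Motives.ComplexPoints.subsingleton_singularCohomology_of_lt (hf.isSmoothProjective s) ℂ
    (k := 2 * p) (by omega)
  rw [Subsingleton.elim (complexBetti.map (Motives.fiberι f s) (2 * p) A) 0]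
  exact Submodule.zero_mem _

end Degrees

/-! ### Global sections of the space of fibre classes -/

section Sections

variable {𝒳 S : Motives.SchemeOver ℂ} (f : 𝒳 ⟶ S) (k : ℕ)

/-- Two global sections `s ↦ (s, A|_{𝒳_s})`, `s ↦ (s, B|_{𝒳_s})` of the space of fibre classes agree
at `s` iff `A|_{𝒳_s} = B|_{𝒳_s}` (the dependent pair `(s, α)` with fixed first component).
[folklore] -/
theorem globalSection_eq_globalSection_iff (A B : complexBetti 𝒳 k) (s : Motives.ComplexPoints S) :
    globalSection f k A s = globalSection f k B s ↔
      complexBetti.map (Motives.fiberι f s) k A = complexBetti.map (Motives.fiberι f s) k B := by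
  constructor
  · intro h
    exact eq_of_heq (FiberClass.mk.inj h).2
  · intro h
    change (⟨s, complexBetti.map (Motives.fiberι f s) k A⟩ : FiberClass f k) =
      ⟨s, complexBetti.map (Motives.fiberι f s) k B⟩
    rw [h]

end Sections

/-! ### Input (A2): the partie fixe in global-class form, from the named fact -/

section PartieFixe

variable {n m : ℕ} {𝒳 Xbar S : Motives.SchemeOver ℂ}

/-- **Input (A2) of André's proof from the named fact `deligne_globalInvariantCycles`.** Let
`f : 𝒳 ⟶ S` be a smooth projective family of relative dimension `n` over a smooth quasi-projective
`ℂ`-scheme `S`, and `i : 𝒳 ⟶ X̄` an open immersion into a projective `ℂ`-scheme `X̄` smooth of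
relative dimension `m` ("une compactification lisse `X̄` de `X`"). Then for every global class
`A ∈ Hᵏ(𝒳(ℂ); ℂ)` and every `s₀ ∈ S(ℂ)` there is `Ā ∈ Hᵏ(X̄(ℂ); ℂ)` with
`Ā|_{𝒳_{s₀}} = A|_{𝒳_{s₀}}`, i.e. `(j_{s₀})^* Ā = A|_{𝒳_{s₀}}` for `j_{s₀} = fiberι f s₀ ≫ i` — the
images of `Hᵏ(X̄(ℂ); ℂ)` and of `Hᵏ(𝒳(ℂ); ℂ)` in `Hᵏ(𝒳_{s₀}(ℂ); ℂ)` agree (Deligne, Hodge II,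
Thm. 4.1.1: "`u : Hᵏ(X̄) → Hᵏ(X) → H⁰(S, Rᵏ f_* ℚ)` est surjective", the value at `s₀` of the global
section `s ↦ A|_{𝒳_s}`; Voisin II, Prop. 4.23). Proof: `globalSection f k A` is a continuous
section of `FiberClass.pt` (`continuous_globalSection`), to which the named fact applies.
[cite: DeligneHodgeII1971, Théorème 4.1.1] [cite: Andre1996Motifs, §5.1 (p. 25)]
[cite: VoisinHodgeII2003, §4.3 Prop. 4.23] -/
theorem exists_map_fiberι_comp_eq_of_deligne (hD : deligne_globalInvariantCycles) (f : 𝒳 ⟶ S)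
    (i : 𝒳 ⟶ Xbar) (hf : Motives.IsSmoothProjectiveFamily f n) (hS : IsQuasiProjectiveOver S)
    (hSs : AlgebraicGeometry.Smooth S.hom) (hXbar : Motives.IsProjectiveOver Xbar)
    [SmoothOfRelativeDimension m Xbar.hom] [IsOpenImmersion i.left] (k : ℕ) (A : complexBetti 𝒳 k)
    (s₀ : Motives.ComplexPoints S) :
    ∃ Ā : complexBetti Xbar k,
      complexBetti.map (Motives.fiberι f s₀ ≫ i) k Ā = complexBetti.map (Motives.fiberι f s₀) k A := by
  obtain ⟨Ā, hĀ⟩ := hD 𝒳 Xbar S f i n m hf hS hSs hXbar ‹_› ‹_› k (globalSection f k A)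
    (continuous_globalSection f k A) (fun _ => rfl) s₀
  refine ⟨Ā, ?_⟩
  rw [complexBetti.map_comp, CategoryTheory.comp_apply]
  exact ((globalSection_eq_globalSection_iff f k _ _ s₀).mp hĀ).symm

end PartieFixe

/-! ### Assembly of §5.1 from its inputs -/

section Assembly

variable {n m : ℕ} {𝒳 Xbar S : Motives.SchemeOver ℂ}

/-- **Assembly of André's proof of Théorème 0.5 (§5.1) on the real carriers, global-class form.**
Let `f : 𝒳 ⟶ S`, `i : 𝒳 ⟶ X̄` (`X̄` of dimension `m`), `A ∈ H²ᵖ(𝒳(ℂ); ℂ)`, `s₀, s ∈ S(ℂ)`, and write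
`j_t = fiberι f t ≫ i : 𝒳_t ⟶ X̄`. Assume the inputs of §5.1 at `(s₀, s)`:
* `hA2` (partie fixe, Deligne Hodge II 4.1.1 — the named fact `deligne_globalInvariantCycles`, see
  `exists_map_fiberι_comp_eq_of_deligne`): `A|_{𝒳_{s₀}} = j_{s₀}^* Ā` for some `Ā ∈ H²ᵖ(X̄(ℂ); ℂ)`;
* `hA3` (the motivic step, Thm. 0.4: "`ξ_s` provient d'un cycle motivé sur `X̄`"): if `j_{s₀}^* Ā`
  is motivated then `j_{s₀}^* Ā = j_{s₀}^* Ā'` for a MOTIVATED `Ā' ∈ A_motᵖ(X̄)_ℂ`;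
* `hA4` (flat sections agreeing at `s₀` agree at `s`): a global class `C ∈ H²ᵖ(𝒳(ℂ); ℂ)` with
  `C|_{𝒳_{s₀}} = 0` has `C|_{𝒳_s} = 0`;
* `hA5` (Prop. 2.1 (ii) and p. 15, stability of `A_mot` under pull-back): `j_s^* Ā'` is motivated for `Ā'`
  motivated.
Then `A|_{𝒳_{s₀}} ∈ A_motᵖ(𝒳_{s₀})_ℂ` implies `A|_{𝒳_s} ∈ A_motᵖ(𝒳_s)_ℂ`: with `Ā'` from
`hA2`/`hA3`, `C = i^* Ā' - A` vanishes on `𝒳_{s₀}`, hence on `𝒳_s`, so `A|_{𝒳_s} = j_s^* Ā'` is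
motivated. (Bookkeeping only — the closing lines "On voit donc que `ξ_t = (H_B(j_t^* ∘ j_s^{*-1}))(ξ_s)`
est motivé si `ξ_s` l'est" of §5.1; the inputs (A3)–(A5) are NOT proved in the tree.)
[cite: Andre1996Motifs, §5.1 (p. 25), Prop. 2.1 (ii) (p. 14) and p. 15] -/
theorem Andre1996_deformation_assembly (f : 𝒳 ⟶ S) (i : 𝒳 ⟶ Xbar) (p : ℕ)
    (A : complexBetti 𝒳 (2 * p)) (s₀ s : Motives.ComplexPoints S)
    (hA2 : ∃ Ā : complexBetti Xbar (2 * p),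
      complexBetti.map (Motives.fiberι f s₀ ≫ i) (2 * p) Ā =
        complexBetti.map (Motives.fiberι f s₀) (2 * p) A)
    (hA3 : ∀ Ā : complexBetti Xbar (2 * p),
      complexBetti.map (Motives.fiberι f s₀ ≫ i) (2 * p) Ā ∈ motivatedClasses n (Motives.fiberOver f s₀) p →
        ∃ Ā' ∈ motivatedClasses m Xbar p,
          complexBetti.map (Motives.fiberι f s₀ ≫ i) (2 * p) Ā' =
            complexBetti.map (Motives.fiberι f s₀ ≫ i) (2 * p) Ā)
    (hA4 : ∀ C : complexBetti 𝒳 (2 * p), complexBetti.map (Motives.fiberι f s₀) (2 * p) C = 0 →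
      complexBetti.map (Motives.fiberι f s) (2 * p) C = 0)
    (hA5 : ∀ Ā' ∈ motivatedClasses m Xbar p,
      complexBetti.map (Motives.fiberι f s ≫ i) (2 * p) Ā' ∈ motivatedClasses n (Motives.fiberOver f s) p)
    (h₀ : complexBetti.map (Motives.fiberι f s₀) (2 * p) A ∈ motivatedClasses n (Motives.fiberOver f s₀) p) :
    complexBetti.map (Motives.fiberι f s) (2 * p) A ∈ motivatedClasses n (Motives.fiberOver f s) p := by
  -- `j_t^* B = (i^* B)|_{𝒳_t}`
  have e : ∀ (t : Motives.ComplexPoints S) (B : complexBetti Xbar (2 * p)),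
      complexBetti.map (Motives.fiberι f t ≫ i) (2 * p) B =
        complexBetti.map (Motives.fiberι f t) (2 * p) (complexBetti.map i (2 * p) B) := fun t B => by
    rw [complexBetti.map_comp, CategoryTheory.comp_apply]
  obtain ⟨Ā, hĀ⟩ := hA2
  obtain ⟨Ā', hĀ'mot, hĀ'⟩ := hA3 Ā (by rw [hĀ]; exact h₀)
  -- `C = i^* Ā' - A` vanishes on `𝒳_{s₀}`, hence on `𝒳_s`
  have hC : complexBetti.map (Motives.fiberι f s) (2 * p) (complexBetti.map i (2 * p) Ā' - A) = 0 := by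
    apply hA4
    rw [map_sub, sub_eq_zero, ← e s₀ Ā', hĀ', hĀ]
  rw [map_sub, sub_eq_zero, ← e s Ā'] at hC
  rw [← hC]
  exact hA5 Ā' hĀ'mot

/-- **Théorème 0.5 over a smooth quasi-projective base from its inputs, (A2) discharged by the named
fact.** In the situation "on peut remplacer `S` par `S'`; dès lors, `X` est un schéma quasi projectif
lisse, et il existe […] une compactification lisse `X̄` de `X`" of §5.1 — `f : 𝒳 ⟶ S` a smooth
projective family of relative dimension `n` over a smooth quasi-projective `S`, `i : 𝒳 ⟶ X̄` an open
immersion into a smooth projective `X̄` of dimension `m` — the partie fixe input (A2) at `s₀` is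
the named fact `deligne_globalInvariantCycles` (`exists_map_fiberι_comp_eq_of_deligne`), and the
conclusion of `Andre1996_deformation` at `(s₀, s)` follows from the remaining inputs (A3) (motivated
lift to `X̄`, Thm. 0.4), (A4) (flat sections) and (A5) (Prop. 2.1 (ii), p. 15) by
`Andre1996_deformation_assembly`. [cite: Andre1996Motifs, §5.1 (p. 25)]
[cite: DeligneHodgeII1971, Théorème 4.1.1] -/
theorem Andre1996_deformation_of_inputs (hD : deligne_globalInvariantCycles) (f : 𝒳 ⟶ S)
    (i : 𝒳 ⟶ Xbar) (hf : Motives.IsSmoothProjectiveFamily f n) (hS : IsQuasiProjectiveOver S)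
    (hSs : AlgebraicGeometry.Smooth S.hom) (hXbar : Motives.IsSmoothProjective m Xbar)
    [IsOpenImmersion i.left] (p : ℕ) (A : complexBetti 𝒳 (2 * p)) (s₀ s : Motives.ComplexPoints S)
    (hA3 : ∀ Ā : complexBetti Xbar (2 * p),
      complexBetti.map (Motives.fiberι f s₀ ≫ i) (2 * p) Ā ∈ motivatedClasses n (Motives.fiberOver f s₀) p →
        ∃ Ā' ∈ motivatedClasses m Xbar p,
          complexBetti.map (Motives.fiberι f s₀ ≫ i) (2 * p) Ā' =
            complexBetti.map (Motives.fiberι f s₀ ≫ i) (2 * p) Ā)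
    (hA4 : ∀ C : complexBetti 𝒳 (2 * p), complexBetti.map (Motives.fiberι f s₀) (2 * p) C = 0 →
      complexBetti.map (Motives.fiberι f s) (2 * p) C = 0)
    (hA5 : ∀ Ā' ∈ motivatedClasses m Xbar p,
      complexBetti.map (Motives.fiberι f s ≫ i) (2 * p) Ā' ∈ motivatedClasses n (Motives.fiberOver f s) p)
    (h₀ : complexBetti.map (Motives.fiberι f s₀) (2 * p) A ∈ motivatedClasses n (Motives.fiberOver f s₀) p) :
    complexBetti.map (Motives.fiberι f s) (2 * p) A ∈ motivatedClasses n (Motives.fiberOver f s) p :=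
  haveI := hXbar.smoothOfRelativeDimension
  Andre1996_deformation_assembly f i p A s₀ s
    (exists_map_fiberι_comp_eq_of_deligne (m := m) hD f i hf hS hSs hXbar.isProjectiveOver (2 * p) A s₀)
    hA3 hA4 hA5 h₀

end Assembly

/-! ### Input (A0), first half: reduction to two points on one irreducible component of the base -/

section Chains

universe u

variable {k : Type u} [Field k] [IsAlgClosed k] {S : Motives.SchemeOver k}

/-- **Propagation along irreducible components.** Let `S` be a connected scheme of finite type over
an algebraically closed field `k` and `P` a property of `k`-points of `S` which propagates between
any two `k`-points lying on a common irreducible component of `S`. Then `P` propagates between any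
two `k`-points of `S`. This is the (elided) first step of André's "Soient `s`, `t` deux points de
`S(ℂ)`. Il existe une variété affine lisse connexe `S'` (par exemple une courbe) et un morphisme
`S' → S` tel que l'image de `S'(ℂ)` dans `S(ℂ)` contienne `s` et `t`" (§5.1): a smooth connected
`S'` has irreducible image, so for a reducible (connected) `S` one argues along a chain of
components. Proof: `S` is Noetherian, so it has finitely many irreducible components, each closed;
call a component *good* if `P` holds at some `k`-point on it (hence at all of them). The union `A`
of the good components and the union `B` of the others are closed and cover `S`; they are disjoint,
because a point common to a good `Z` and a bad `Z'` gives a non-empty closed `Z ∩ Z'`, which contains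
a closed point (`S` is quasi-compact and `T₀`), i.e. a `k`-point (`k = k̄`, Nullstellensatz:
`Motives.EsnaultLevineViehweg.exists_algPoints_pt_eq`), at which `P` holds — making `Z'` good. So `A`
is clopen and non-empty, hence everything. [cite: Andre1996Motifs, §5.1 (p. 25)] -/
theorem _root_.Literature.AlgebraicGeometry.Motives.AlgPoints.forall_of_irreducibleComponents
    [LocallyOfFiniteType S.hom] [QuasiCompact S.hom] [ConnectedSpace S.left]
    (P : Motives.AlgPoints S k → Prop)
    (hP : ∀ Z ∈ irreducibleComponents S.left, ∀ s t : Motives.AlgPoints S k,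
      s.pt ∈ Z → t.pt ∈ Z → P s → P t)
    {s₀ : Motives.AlgPoints S k} (h₀ : P s₀) (s : Motives.AlgPoints S k) : P s := by
  classical
  haveI : IsLocallyNoetherian S.left := LocallyOfFiniteType.isLocallyNoetherian S.hom
  haveI : CompactSpace S.left := QuasiCompact.compactSpace_of_compactSpace S.hom
  haveI : IsNoetherian S.left := {}
  have hfin : (irreducibleComponents (S.left : Type u)).Finite :=
    TopologicalSpace.NoetherianSpace.finite_irreducibleComponents
  -- the good components: those carrying a `k`-point at which `P` holds
  set good : Set (Set S.left) :=
    {Z | Z ∈ irreducibleComponents (S.left : Type u) ∧ ∃ t : Motives.AlgPoints S k, t.pt ∈ Z ∧ P t}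
    with hgood
  have hgoodP : ∀ Z ∈ good, ∀ t : Motives.AlgPoints S k, t.pt ∈ Z → P t := by
    rintro Z ⟨hZ, t₀, ht₀, hPt₀⟩ t ht
    exact hP Z hZ t₀ t ht₀ ht hPt₀
  set A : Set S.left := ⋃ Z ∈ good, Z with hA
  set B : Set S.left := ⋃ Z ∈ irreducibleComponents (S.left : Type u) \ good, Z with hB
  have hAc : IsClosed A :=
    (hfin.subset fun Z hZ => hZ.1).isClosed_biUnion fun Z hZ =>
      isClosed_of_mem_irreducibleComponents Z hZ.1
  have hBc : IsClosed B :=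
    (hfin.subset Set.sdiff_subset).isClosed_biUnion fun Z hZ =>
      isClosed_of_mem_irreducibleComponents Z hZ.1
  -- `A ∪ B = S`
  have hAB : ∀ x : S.left, x ∈ A ∨ x ∈ B := fun x => by
    by_cases hx : irreducibleComponent x ∈ good
    · exact Or.inl (Set.mem_biUnion hx mem_irreducibleComponent)
    · exact Or.inr (Set.mem_biUnion ⟨irreducibleComponent_mem_irreducibleComponents x, hx⟩
        mem_irreducibleComponent)
  -- `A ∩ B = ∅`: a common point of a good and a bad component yields a `k`-point of the bad one
  -- at which `P` holds
  have hdisj : ∀ x : S.left, x ∈ A → x ∉ B := fun x hxA hxB => by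
    obtain ⟨Z, hZ, hxZ⟩ := Set.mem_iUnion₂.mp hxA
    obtain ⟨Z', hZ', hxZ'⟩ := Set.mem_iUnion₂.mp hxB
    have hcl : IsClosed (Z ∩ Z') :=
      (isClosed_of_mem_irreducibleComponents Z hZ.1).inter
        (isClosed_of_mem_irreducibleComponents Z' hZ'.1)
    obtain ⟨y, ⟨hyZ, hyZ'⟩, hy⟩ := hcl.exists_closed_singleton ⟨x, hxZ, hxZ'⟩
    obtain ⟨t, rfl⟩ := Motives.EsnaultLevineViehweg.exists_algPoints_pt_eq (X := S) hy
    exact hZ'.2 ⟨hZ'.1, t, hyZ', hgoodP Z hZ t hyZ⟩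
  -- hence `A` is clopen and non-empty, so `A = S`
  have hAo : IsOpen A := by
    have hc : Aᶜ = B := by
      ext x
      constructor
      · intro hx
        exact (hAB x).resolve_left hx
      · intro hx hxA
        exact hdisj x hxA hx
    rw [← isClosed_compl_iff, hc]
    exact hBc
  have hs₀ : s₀.pt ∈ A :=
    Set.mem_biUnion (show irreducibleComponent s₀.pt ∈ good from
      ⟨irreducibleComponent_mem_irreducibleComponents _, s₀, mem_irreducibleComponent, h₀⟩)
      mem_irreducibleComponent
  have hAu : A = Set.univ := IsClopen.eq_univ ⟨hAc, hAo⟩ ⟨s₀.pt, hs₀⟩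
  have hs : s.pt ∈ A := hAu ▸ Set.mem_univ _
  obtain ⟨Z, hZ, hsZ⟩ := Set.mem_iUnion₂.mp hs
  exact hgoodP Z hZ s hsZ

end Chains

section ChainsDeformation

/-- **`Andre1996_deformation` reduces to pairs of points on one irreducible component of the base**
(first half of step (A0) of §5.1, PROVED): if for every smooth projective family `f : 𝒳 ⟶ S` as in
the statement (but WITHOUT the connectedness of `S`), every `A ∈ H²ᵖ(𝒳(ℂ); ℂ)`, every irreducible
component `Z` of `S` and all `s, t ∈ S(ℂ)` lying on `Z`, `A|_{𝒳_s}` motivated implies `A|_{𝒳_t}`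
motivated, then `Andre1996_deformation` holds — by `Motives.AlgPoints.forall_of_irreducibleComponents`
applied on the connected `S` to the property "`A|_{𝒳_s}` is motivated". The hypothesis is what the
rest of André's proof establishes (an irreducible curve through `s` and `t`, base change, Hironaka,
partie fixe, Thm. 0.4, Prop. 2.1). [cite: Andre1996Motifs, Thm. 0.5 (p. 8) and §5.1 (p. 25)] -/
theorem Andre1996_deformation_of_irreducibleComponents
    (h : ∀ ⦃n : ℕ⦄ ⦃𝒳 S : Motives.SchemeOver ℂ⦄ (f : 𝒳 ⟶ S), Motives.IsSmoothProjectiveFamily f n →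
      (∃ (N : ℕ) (ι : 𝒳 ⟶ Motives.projectiveSpace N ℂ ⊗ S),
          IsClosedImmersion ι.left ∧ ι ≫ snd (Motives.projectiveSpace N ℂ) S = f) →
      IsReduced S.left → LocallyOfFiniteType S.hom → QuasiCompact S.hom →
      ∀ (p : ℕ) (A : complexBetti 𝒳 (2 * p)) (Z : Set S.left), Z ∈ irreducibleComponents S.left →
      ∀ (s t : Motives.ComplexPoints S), s.pt ∈ Z → t.pt ∈ Z →
        complexBetti.map (Motives.fiberι f s) (2 * p) A ∈ motivatedClasses n (Motives.fiberOver f s) p →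
        complexBetti.map (Motives.fiberι f t) (2 * p) A ∈ motivatedClasses n (Motives.fiberOver f t) p) :
    Andre1996_deformation := by
  intro n 𝒳 S f hf hι hred hconn hft hqc p A s₀ h₀ s
  haveI := hconn
  haveI := hft
  haveI := hqc
  exact Motives.AlgPoints.forall_of_irreducibleComponents
    (fun t : Motives.ComplexPoints S =>
      complexBetti.map (Motives.fiberι f t) (2 * p) A ∈ motivatedClasses n (Motives.fiberOver f t) p)
    (fun Z hZ s t hs ht hPs => h f hf hι hred hft hqc p A Z hZ s t hs ht hPs) h₀ s

end ChainsDeformation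

end Literature.AlgebraicGeometry.HodgeTheory

namespace Literature.AlgebraicGeometry.Motives

/-! ### Input (A0), second half: base change of families along a morphism of bases -/

universe w

section FamilyPullback

variable {k : Type w} [Field k] {𝒳 S S' : SchemeOver k} (f : 𝒳 ⟶ S) (g : S' ⟶ S)

/-- **Base change of a family along a morphism of bases**: for `f : 𝒳 ⟶ S` and `g : S' ⟶ S` over
`k`, the `k`-scheme `𝒳 ×_S S'` (Mathlib `Limits.pullback f.left g.left`, structure map through `𝒳`;
Hartshorne II.3 "base extension"). [folklore] -/
def familyPullback : SchemeOver k :=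
  Over.mk (pullback.fst f.left g.left ≫ 𝒳.hom)

/-- The underlying scheme of `familyPullback f g` is `𝒳 ×_S S'` (by `rfl`). [folklore] -/
@[simp]
theorem familyPullback_left : (familyPullback f g).left = pullback f.left g.left := rfl

/-- The structure map of `familyPullback f g` is `𝒳 ×_S S' → 𝒳 → Spec k` (by `rfl`). [folklore] -/
theorem familyPullback_hom : (familyPullback f g).hom = pullback.fst f.left g.left ≫ 𝒳.hom := rfl

/-- The projection `𝒳 ×_S S' ⟶ 𝒳` of the base change, over `k`. [folklore] -/
def familyPullback.fst : familyPullback f g ⟶ 𝒳 :=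
  Over.homMk (pullback.fst f.left g.left) rfl

/-- The **base-changed family** `f' : 𝒳 ×_S S' ⟶ S'`, over `k`. [folklore] -/
def familyPullback.snd : familyPullback f g ⟶ S' :=
  Over.homMk (pullback.snd f.left g.left) (by
    change pullback.snd f.left g.left ≫ S'.hom = pullback.fst f.left g.left ≫ 𝒳.hom
    rw [← Over.w g, ← Category.assoc, ← pullback.condition, Category.assoc, Over.w f])

/-- `(familyPullback.fst f g).left = pullback.fst` (by `rfl`). [folklore] -/
@[simp]
theorem familyPullback.fst_left : (familyPullback.fst f g).left = pullback.fst f.left g.left := rfl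

/-- `(familyPullback.snd f g).left = pullback.snd` (by `rfl`). [folklore] -/
@[simp]
theorem familyPullback.snd_left : (familyPullback.snd f g).left = pullback.snd f.left g.left := rfl

/-- The base-change square commutes: `𝒳 ×_S S' → 𝒳 → S` equals `𝒳 ×_S S' → S' → S`. [folklore] -/
theorem familyPullback.condition :
    familyPullback.fst f g ≫ f = familyPullback.snd f g ≫ g := by
  ext : 1
  exact pullback.condition

/-- The base-change square is cartesian in `k`-schemes. [folklore] -/
theorem familyPullback.isPullback :
    IsPullback (familyPullback.fst f g) (familyPullback.snd f g) f g := by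
  refine IsPullback.of_map (Over.forget _) (familyPullback.condition f g) ?_
  exact IsPullback.of_hasPullback f.left g.left

/-- **The fibre of the base change over `s' ∈ S'(k)` is the fibre of `f` over `g(s')`**:
`(𝒳 ×_S S') ×_{S'} Spec k ≅ 𝒳 ×_S Spec k` for `Spec k → S' → S` (transitivity of base change,
Mathlib `pullbackLeftPullbackSndIso`), as an isomorphism of `k`-schemes. [folklore] -/
def fiberOverFamilyPullbackIso (s' : AlgPoints S' k) :
    fiberOver (familyPullback.snd f g) s' ≅ fiberOver f (AlgPoints.map g s') :=
  Over.isoMk (pullbackLeftPullbackSndIso f.left g.left s'.left) (by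
    change (pullbackLeftPullbackSndIso f.left g.left s'.left).hom ≫
        pullback.fst f.left (s'.left ≫ g.left) ≫ 𝒳.hom =
      pullback.fst (pullback.snd f.left g.left) s'.left ≫ (pullback.fst f.left g.left ≫ 𝒳.hom)
    rw [← Category.assoc, pullbackLeftPullbackSndIso_hom_fst, Category.assoc])

/-- Compatibility of `fiberOverFamilyPullbackIso` with the fibre inclusions:
`(𝒳 ×_S S')_{s'} ≅ 𝒳_{g(s')} ⟶ 𝒳` is `(𝒳 ×_S S')_{s'} ⟶ 𝒳 ×_S S' ⟶ 𝒳`. [folklore] -/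
theorem fiberOverFamilyPullbackIso_hom_fiberι (s' : AlgPoints S' k) :
    (fiberOverFamilyPullbackIso f g s').hom ≫ fiberι f (AlgPoints.map g s') =
      fiberι (familyPullback.snd f g) s' ≫ familyPullback.fst f g := by
  ext : 1
  exact pullbackLeftPullbackSndIso_hom_fst f.left g.left s'.left

variable {f} in
/-- **Smooth projective families are stable under base change**: smoothness of relative dimension
`n` and properness are stable under base change (Mathlib), and the fibre of `f'` over `s' ∈ S'(k)`
is the fibre of `f` over `g(s')` (`fiberOverFamilyPullbackIso`), a smooth projective variety
(`IsSmoothProjective.of_iso`). [folklore] -/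
theorem IsSmoothProjectiveFamily.familyPullback_snd {n : ℕ} (hf : IsSmoothProjectiveFamily f n) :
    IsSmoothProjectiveFamily (familyPullback.snd f g) n := by
  haveI := hf.isProper
  refine ⟨?_, ?_, fun s' => ?_⟩
  · change SmoothOfRelativeDimension n (pullback.snd f.left g.left)
    haveI := smoothOfRelativeDimension_isStableUnderBaseChange (n := n)
    exact MorphismProperty.pullback_snd (P := @SmoothOfRelativeDimension n) _ _
      hf.smoothOfRelativeDimension
  · change IsProper (pullback.snd f.left g.left)
    infer_instance
  · exact (hf.isSmoothProjective (AlgPoints.map g s')).of_iso (fiberOverFamilyPullbackIso f g s').symm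

/-- **`X ⊗ S'` is the base change of `X ⊗ S → S` along `g : S' ⟶ S`** in `k`-schemes: the square
`X ⊗ S' → S'`, `X ⊗ S' → X ⊗ S` (`X ◁ g`), `g`, `X ⊗ S → S` is cartesian (a cone `(a, b)` with
`a ≫ pr_S = b ≫ g` factors uniquely as `(a ≫ pr_X, b)`). [folklore] -/
theorem isPullback_snd_whiskerLeft (X : SchemeOver k) :
    IsPullback (CartesianMonoidalCategory.snd X S') (X ◁ g) g (CartesianMonoidalCategory.snd X S) := by
  refine IsPullback.of_isLimit' ⟨(whiskerLeft_snd X g).symm⟩ (PullbackCone.IsLimit.mk _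
    (fun c => CartesianMonoidalCategory.lift (c.snd ≫ CartesianMonoidalCategory.fst X S) c.fst)
    (fun c => lift_snd _ _) (fun c => ?_) (fun c m h₁ h₂ => ?_))
  · refine CartesianMonoidalCategory.hom_ext _ _ ?_ ?_
    · rw [Category.assoc, whiskerLeft_fst, lift_fst]
    · rw [Category.assoc, whiskerLeft_snd, lift_snd_assoc]
      exact c.condition
  · refine CartesianMonoidalCategory.hom_ext _ _ ?_ ?_
    · rw [lift_fst, ← h₂, Category.assoc, whiskerLeft_fst]
    · rw [lift_snd]
      exact h₁

/-- **Projectivity in Hartshorne's sense is stable under base change**: if `f : 𝒳 ⟶ S` factors as a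
closed immersion `ι : 𝒳 ⟶ ℙᴺ × S` followed by the projection, then the base-changed family
`𝒳 ×_S S' ⟶ S'` factors as the closed immersion `(ι ∘ pr_𝒳, f') : 𝒳 ×_S S' ⟶ ℙᴺ × S'` — the base
change of `ι` along `ℙᴺ × S' → ℙᴺ × S` (pasting of cartesian squares; closed immersions are stable
under base change) — followed by the projection (Hartshorne II §4, p. 103). [folklore] -/
theorem exists_isClosedImmersion_familyPullback
    (hι : ∃ (N : ℕ) (ι : 𝒳 ⟶ projectiveSpace N k ⊗ S),
      IsClosedImmersion ι.left ∧ ι ≫ CartesianMonoidalCategory.snd (projectiveSpace N k) S = f) :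
    ∃ (N : ℕ) (ι' : familyPullback f g ⟶ projectiveSpace N k ⊗ S'),
      IsClosedImmersion ι'.left ∧
        ι' ≫ CartesianMonoidalCategory.snd (projectiveSpace N k) S' = familyPullback.snd f g := by
  obtain ⟨N, ι, hι, hιf⟩ := hι
  refine ⟨N, CartesianMonoidalCategory.lift
    (familyPullback.fst f g ≫ ι ≫ CartesianMonoidalCategory.fst (projectiveSpace N k) S)
    (familyPullback.snd f g), ?_, lift_snd _ _⟩
  -- `ι' = (ι ∘ pr_𝒳, f')` is the base change of `ι` along `ℙᴺ ◁ g`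
  have hsq : IsPullback
      (CartesianMonoidalCategory.lift
        (familyPullback.fst f g ≫ ι ≫ CartesianMonoidalCategory.fst (projectiveSpace N k) S)
        (familyPullback.snd f g))
      (familyPullback.fst f g) (projectiveSpace N k ◁ g) ι := by
    refine IsPullback.of_right (h₁₂ := CartesianMonoidalCategory.snd (projectiveSpace N k) S')
      (h₂₂ := CartesianMonoidalCategory.snd (projectiveSpace N k) S) (v₁₃ := g) ?_ ?_
      (isPullback_snd_whiskerLeft g (projectiveSpace N k))
    · rw [lift_snd, hιf]
      exact (familyPullback.isPullback f g).flip
    · refine CartesianMonoidalCategory.hom_ext _ _ ?_ ?_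
      · rw [Category.assoc, whiskerLeft_fst, lift_fst, Category.assoc]
      · rw [Category.assoc, whiskerLeft_snd, lift_snd_assoc, Category.assoc, hιf]
        exact (familyPullback.condition f g).symm
  exact MorphismProperty.of_isPullback (P := @IsClosedImmersion) (hsq.map (Over.forget _)).flip hι

end FamilyPullback

end Literature.AlgebraicGeometry.Motives

namespace Literature.AlgebraicGeometry.HodgeTheory

/-! ### Input (A0) assembled: reduction to smooth irreducible quasi-projective bases, granted curves -/

section CurveReduction

variable {n : ℕ} {𝒳 S S' : Motives.SchemeOver ℂ}

/-- A quasi-projective `ℂ`-scheme is locally of finite type over `ℂ` (open immersion into a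
projective, hence proper, `ℂ`-scheme; Hartshorne II Thm. 4.9). [folklore] -/
theorem IsQuasiProjectiveOver.locallyOfFiniteType {T : Motives.SchemeOver ℂ}
    (h : IsQuasiProjectiveOver T) : LocallyOfFiniteType T.hom := by
  obtain ⟨P, j, hP, hj⟩ := h
  haveI : IsProper P.hom := hP.isProper
  rw [show T.hom = j.left ≫ P.hom from (Over.w j).symm]
  infer_instance

/-- **Restrictions to the fibres of a base change.** For `f : 𝒳 ⟶ S`, `g : S' ⟶ S`, a global class
`A ∈ Hᵏ(𝒳(ℂ); ℂ)` and `u ∈ S'(ℂ)`: the restriction of `pr_𝒳^* A` to the fibre `(𝒳 ×_S S')_u` is the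
pull-back, along the canonical isomorphism `(𝒳 ×_S S')_u ≅ 𝒳_{g(u)}` (`fiberOverFamilyPullbackIso`),
of the restriction of `A` to `𝒳_{g(u)}`. [folklore] -/
theorem map_fiberι_familyPullback (f : 𝒳 ⟶ S) (g : S' ⟶ S) (k : ℕ) (A : complexBetti 𝒳 k)
    (u : Motives.ComplexPoints S') :
    complexBetti.map (Motives.fiberι (Motives.familyPullback.snd f g) u) k
        (complexBetti.map (Motives.familyPullback.fst f g) k A) =
      complexBetti.map (Motives.fiberOverFamilyPullbackIso f g u).hom k
        (complexBetti.map (Motives.fiberι f (Motives.AlgPoints.map g u)) k A) := by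
  rw [← CategoryTheory.comp_apply, ← complexBetti.map_comp, ← CategoryTheory.comp_apply,
    ← complexBetti.map_comp, Motives.fiberOverFamilyPullbackIso_hom_fiberι]

/-- **Motivated restrictions are invariant under base change**: with notation as in
`map_fiberι_familyPullback` and `f` a smooth projective family of relative dimension `n`,
`(pr_𝒳^* A)|_{(𝒳 ×_S S')_u}` is motivated iff `A|_{𝒳_{g(u)}}` is (transport along the isomorphism
of fibres, `map_mem_motivatedClasses_iff_of_iso`). [cite: Andre1996Motifs, §5.1 (p. 25)] -/
theorem map_fiberι_familyPullback_mem_motivatedClasses_iff (f : 𝒳 ⟶ S)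
    (hf : Motives.IsSmoothProjectiveFamily f n) (g : S' ⟶ S) (p : ℕ) (A : complexBetti 𝒳 (2 * p))
    (u : Motives.ComplexPoints S') :
    complexBetti.map (Motives.fiberι (Motives.familyPullback.snd f g) u) (2 * p)
        (complexBetti.map (Motives.familyPullback.fst f g) (2 * p) A) ∈
          motivatedClasses n (Motives.fiberOver (Motives.familyPullback.snd f g) u) p ↔
      complexBetti.map (Motives.fiberι f (Motives.AlgPoints.map g u)) (2 * p) A ∈
        motivatedClasses n (Motives.fiberOver f (Motives.AlgPoints.map g u)) p := by
  rw [map_fiberι_familyPullback]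
  exact map_mem_motivatedClasses_iff_of_iso (hf.isSmoothProjective _)
    ((hf.familyPullback_snd g).isSmoothProjective u) (Motives.fiberOverFamilyPullbackIso f g u) _

/-- **Step (A0) of André's proof of Théorème 0.5 (§5.1), assembled: `Andre1996_deformation` reduces to
families over smooth irreducible quasi-projective bases, GRANTED curves through pairs of points.**
"Soient `s`, `t` deux points de `S(ℂ)`. Il existe une variété affine lisse connexe `S'` (par exemple
une courbe) et un morphisme `S' → S` tel que l'image de `S'(ℂ)` dans `S(ℂ)` contienne `s` et `t`.
Puisque la formation de `R²ᵖ f_* ℚ_X(p)` commute à tout changement de base, on peut remplacer `S`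
par `S'`." Inputs: `hcurve` — for `s`, `t ∈ S(ℂ)` on one irreducible component of a `ℂ`-scheme of
finite type there are a smooth irreducible quasi-projective `S'`, `g : S' ⟶ S` and
`s', t' ∈ S'(ℂ)` over `s`, `t` (an irreducible curve through two points of an irreducible variety,
normalised; NOT proved in the tree); `hmain` — the statement of `Andre1996_deformation` for families
over smooth irreducible quasi-projective bases `S`, which moreover receive `S(ℂ)` connected (SGA1 XII
Prop. 2.4, the tree's PROVED `Motives.ComplexPoints.connectedSpace_iff_holds`; steps (A1)–(A5) remain). Proof: reduce to pairs on one
component (`Andre1996_deformation_of_irreducibleComponents`), base-change the family to `S'`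
(`Motives.familyPullback`: again a smooth projective family, `IsSmoothProjectiveFamily.familyPullback_snd`,
projective in Hartshorne's sense, `Motives.exists_isClosedImmersion_familyPullback`), and move the
hypothesis at `s` and the conclusion at `t` across the isomorphisms of fibres
(`map_fiberι_familyPullback_mem_motivatedClasses_iff`). [cite: Andre1996Motifs, §5.1 (p. 25)] -/
theorem Andre1996_deformation_of_curves
    (hcurve : ∀ (S : Motives.SchemeOver ℂ), LocallyOfFiniteType S.hom → QuasiCompact S.hom →
      ∀ Z ∈ irreducibleComponents S.left, ∀ (s t : Motives.ComplexPoints S), s.pt ∈ Z → t.pt ∈ Z →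
        ∃ (S' : Motives.SchemeOver ℂ) (g : S' ⟶ S) (s' t' : Motives.ComplexPoints S'),
          AlgebraicGeometry.Smooth S'.hom ∧ IsQuasiProjectiveOver S' ∧ IrreducibleSpace S'.left ∧
            Motives.AlgPoints.map g s' = s ∧ Motives.AlgPoints.map g t' = t)
    (hmain : ∀ ⦃n : ℕ⦄ ⦃𝒳 S : Motives.SchemeOver ℂ⦄ (f : 𝒳 ⟶ S),
      Motives.IsSmoothProjectiveFamily f n →
      (∃ (N : ℕ) (ι : 𝒳 ⟶ Motives.projectiveSpace N ℂ ⊗ S),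
          IsClosedImmersion ι.left ∧ ι ≫ snd (Motives.projectiveSpace N ℂ) S = f) →
      AlgebraicGeometry.Smooth S.hom → IsQuasiProjectiveOver S → IrreducibleSpace S.left →
      ConnectedSpace (Motives.ComplexPoints S) →
      ∀ (p : ℕ) (A : complexBetti 𝒳 (2 * p)) (s t : Motives.ComplexPoints S),
        complexBetti.map (Motives.fiberι f s) (2 * p) A ∈ motivatedClasses n (Motives.fiberOver f s) p →
        complexBetti.map (Motives.fiberι f t) (2 * p) A ∈ motivatedClasses n (Motives.fiberOver f t) p) :
    Andre1996_deformation := by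
  refine Andre1996_deformation_of_irreducibleComponents
    fun n 𝒳 S f hf hι _ hft hqc p A Z hZ s t hs ht hAs => ?_
  obtain ⟨S', g, s', t', hS'sm, hS'qp, hS'irr, rfl, rfl⟩ := hcurve S hft hqc Z hZ s t hs ht
  have hf' := hf.familyPullback_snd g
  -- `S'(ℂ)` is connected: `S'` is irreducible, hence connected, and of finite type (SGA1 XII 2.4)
  haveI : LocallyOfFiniteType S'.hom := hS'qp.locallyOfFiniteType
  haveI : IrreducibleSpace S'.left := hS'irr
  have hconn : ConnectedSpace (Motives.ComplexPoints S') :=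
    (Motives.ComplexPoints.connectedSpace_iff_holds S').2 inferInstance
  exact (map_fiberι_familyPullback_mem_motivatedClasses_iff f hf g p A t').1
    (hmain _ hf' (Motives.exists_isClosedImmersion_familyPullback f g hι) hS'sm hS'qp hS'irr hconn p _
      s' t' ((map_fiberι_familyPullback_mem_motivatedClasses_iff f hf g p A s').2 hAs))

/-- **André's proof of Théorème 0.5 (§5.1) as a whole: `Andre1996_deformation` from its six classical
inputs**, each stated on the real carriers in the form the steps above consume it (HYPOTHESES here —
none but (A2) is a named fact of the tree, and this theorem introduces none):
* `hcurve` (A0: "Il existe une variété affine lisse connexe `S'` (par exemple une courbe) et un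
  morphisme `S' → S` tel que l'image de `S'(ℂ)` dans `S(ℂ)` contienne `s` et `t`" — an irreducible
  curve through two points of an irreducible variety, normalised);
* `hcomp` (A1: "`X` est un schéma quasi projectif lisse, et il existe, d'après H. Hironaka, une
  compactification lisse `X̄` de `X`");
* `hD` (A2: Deligne's théorème de la partie fixe, Hodge II 4.1.1 — the tree's named fact
  `deligne_globalInvariantCycles`);
* `h04` (A3: the semisimplicity of motivated motives, Thm. 0.4, in the form used in §5.1: a class of
  `X̄` whose pull-back along `j : X ⟶ X̄` is motivated has the same pull-back as a MOTIVATED class of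
  `X̄` — "`ξ_s` provient d'un cycle motivé sur `X̄`");
* `hflat` (A4: the restrictions of a global class to the fibres of a smooth projective family over a
  smooth quasi-projective base with connected complex points vanish at every point if they vanish at
  one — flat sections of the local system `R²ᵖ f_* ℂ`, "`ξ_t = (H_B(j_t^* ∘ j_s^{*-1}))(ξ_s)`");
* `h21` (A5: Prop. 2.1 (ii) and p. 15 — `A_mot` is stable under pull-backs `j^*`).
Assembly: `Andre1996_deformation_of_curves` (A0); then, at each pair `(s, t)` over the smooth
irreducible quasi-projective `S` with `S(ℂ)` connected, `Andre1996_deformation_of_inputs` with the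
compactification provided by `hcomp`. [cite: Andre1996Motifs, Thm. 0.5 (p. 8) and §5.1 (p. 25)]
[cite: DeligneHodgeII1971, Théorème 4.1.1] -/
theorem Andre1996_deformation_of_classical_inputs
    (hcurve : ∀ (S : Motives.SchemeOver ℂ), LocallyOfFiniteType S.hom → QuasiCompact S.hom →
      ∀ Z ∈ irreducibleComponents S.left, ∀ (s t : Motives.ComplexPoints S), s.pt ∈ Z → t.pt ∈ Z →
        ∃ (S' : Motives.SchemeOver ℂ) (g : S' ⟶ S) (s' t' : Motives.ComplexPoints S'),
          AlgebraicGeometry.Smooth S'.hom ∧ IsQuasiProjectiveOver S' ∧ IrreducibleSpace S'.left ∧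
            Motives.AlgPoints.map g s' = s ∧ Motives.AlgPoints.map g t' = t)
    (hcomp : ∀ ⦃n : ℕ⦄ ⦃𝒳 S : Motives.SchemeOver ℂ⦄ (f : 𝒳 ⟶ S),
      Motives.IsSmoothProjectiveFamily f n →
      (∃ (N : ℕ) (ι : 𝒳 ⟶ Motives.projectiveSpace N ℂ ⊗ S),
          IsClosedImmersion ι.left ∧ ι ≫ snd (Motives.projectiveSpace N ℂ) S = f) →
      AlgebraicGeometry.Smooth S.hom → IsQuasiProjectiveOver S → IrreducibleSpace S.left →
      ∃ (m : ℕ) (Xbar : Motives.SchemeOver ℂ) (i : 𝒳 ⟶ Xbar),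
        Motives.IsSmoothProjective m Xbar ∧ IsOpenImmersion i.left)
    (hD : deligne_globalInvariantCycles)
    (h04 : ∀ ⦃m n : ℕ⦄ ⦃Xbar X : Motives.SchemeOver ℂ⦄ (j : X ⟶ Xbar),
      Motives.IsSmoothProjective m Xbar → Motives.IsSmoothProjective n X →
      ∀ (p : ℕ) (Ā : complexBetti Xbar (2 * p)),
        complexBetti.map j (2 * p) Ā ∈ motivatedClasses n X p →
        ∃ Ā' ∈ motivatedClasses m Xbar p, complexBetti.map j (2 * p) Ā' = complexBetti.map j (2 * p) Ā)
    (hflat : ∀ ⦃n : ℕ⦄ ⦃𝒳 S : Motives.SchemeOver ℂ⦄ (f : 𝒳 ⟶ S),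
      Motives.IsSmoothProjectiveFamily f n → AlgebraicGeometry.Smooth S.hom → IsQuasiProjectiveOver S →
      ConnectedSpace (Motives.ComplexPoints S) →
      ∀ (k : ℕ) (C : complexBetti 𝒳 k) (s t : Motives.ComplexPoints S),
        complexBetti.map (Motives.fiberι f s) k C = 0 → complexBetti.map (Motives.fiberι f t) k C = 0)
    (h21 : ∀ ⦃m n : ℕ⦄ ⦃Xbar X : Motives.SchemeOver ℂ⦄ (j : X ⟶ Xbar),
      Motives.IsSmoothProjective m Xbar → Motives.IsSmoothProjective n X →
      ∀ (p : ℕ), ∀ Ā' ∈ motivatedClasses m Xbar p,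
        complexBetti.map j (2 * p) Ā' ∈ motivatedClasses n X p) :
    Andre1996_deformation := by
  refine Andre1996_deformation_of_curves hcurve
    fun n 𝒳 S f hf hι hSsm hSqp hSirr hSconn p A s t hAs => ?_
  obtain ⟨m, Xbar, i, hXbar, hi⟩ := hcomp f hf hι hSsm hSqp hSirr
  haveI := hi
  exact Andre1996_deformation_of_inputs hD f i hf hSqp hSsm hXbar p A s t
    (fun Ā h => h04 (Motives.fiberι f s ≫ i) hXbar (hf.isSmoothProjective s) p Ā h)
    (fun C hC => hflat f hf hSsm hSqp hSconn (2 * p) C s t hC)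
    (fun Ā' h => h21 (Motives.fiberι f t ≫ i) hXbar (hf.isSmoothProjective t) p Ā' h) hAs

end CurveReduction

end Literature.AlgebraicGeometry.HodgeTheory

end
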